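import Mathlib
import HarnessLib
import Summits.HubbardSuperconductivity.HubbardSuperconductivity.Theorems.KLProgrammeKLRegimeEnginePairTransferRelIdxStep

/-!
# Route `KLProgramme` — ENGINE child gen 8 (stmt-HubbardSuperconductivity-20437 `KLRegimeEngineV17F2`), skeleton v2 class #5 rev 3 (RELATIVE family, INDEX form):
# the RELATIVE-RESIDUE organisation of the producer (private invariant `‖Ẽ‖ ≤ Rb`, ONE forward conversion per scale at export) —
# `kltc_relResidue_eq_zero_off`, `pairTransferRelAt_of_relResidue`, **`pairTransferRelRes_succ_keyed`** (cell gate-hubbard-kl, seat hubbard-kl-k3c1-p1 g11,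
# technique «composed-map remainder propagation»; answer to located item #19 «(c)-DRESSING-AVG», plan g21 (R90))

WHY.  In the forward-form chain (`pairTransferRelAt_succ_keyed`, p592121) the inherited bar is CONVOLVED with the relative weights `aʰ, a(0), a(1)` four times per step
(fwd → Ẽ at the start, Ẽ → fwd for the door's `M₀`, fwd → Ẽ inside `kltc_relative_step_fwd`, Ẽ → fwd at the end), and p1 g13 located that each such convolution on the
GAIN slots of the bar needs the label DISTRIBUTION of the weight (sup × mass is dead at deep `n`).  Those four conversions are artefacts of passing the induction
through the FORWARD form of the frozen clause.  `kltc_relative_flow_duhamel` (p583555) is already stated in the relative residue `Ẽ = A₁ + A₁·diag a·A₂ − A₂`: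
`‖Ẽ(1)(x,y)‖ ≤ FT_ρ(S)(x,y)`, `S ≥ ‖Ẽ(0)(x,y)‖ + FT-weighted ∫‖X_rel‖ + defect`, NO inverse, NO `a`-convolution.  So the producer may carry the PRIVATE invariant
«`‖Ẽ_n(j,j′)(k,k′)‖ ≤ Rb n j′ Qm k k′` on the bare ball» (bar `Rb` of its choice) through the induction and export the frozen forward clause ONCE per scale
(`pairTransferRelAt_of_relResidue`: one `a`-convolution, not inherited); `PairTransferStep5` is then proved by the producer's own induction on `n` under its binders
(the `∀ j < n, …K5 j` history it is handed may stay unused).  Per step the inherited bar is convolved with the slice profiles `ρᵢ` ONLY (the four-term dressing —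
intrinsic: the ladder transports labels), whose windowed masses are the (W2) lines of the shell, discharged against `klRelGain` by `klam_relGain_angular_le` (p593991).
* `kltc_relResidue_eq_zero_off` — the relative residue of ball-truncated arrays vanishes off the bare ball (so a ball bound is a global bound);
* **`pairTransferRelAt_of_relResidue`** — EXPORT: `‖Ẽ_n(x,y)‖ ≤ T(x,y)` everywhere, `|A°_n[ψ₂]| ≤ m`, `m·Σ|t₁ − t₂| ≤ 1/3`, `T + Σ_c T(k,c)|t₁−t₂|_c(3m/2) ≤ Tb` on the ball
  ⟹ `PairTransferRelAt … n Tb ψ₁ ψ₂`;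
* **`pairTransferRelRes_succ_keyed`** — the Ẽ-form keyed step: history `‖Ẽʰ(k,k′)‖ ≤ Rh Qm k k′` on the ball (arrays `klMemberArrayF n χᵢ`, weight `−(t_n[χ₁] − t_n[χ₂])`),
  the member curves pinned by the nine equations of `pairTransferRelAt_succ_keyed`, and per class the SIZES bundle WITHOUT the `T₀ → R₀ → δ` conversion chain and
  WITHOUT `m·Σ|a(0)|, m·Σ|a(1)| ≤ 1/3`: start majorant `T₀ ≥ Rh·𝟙 + η_rel + m·Ση₁|a(0)| + m²Σd + m·Σ|aʰ|η₂` (frame terms only), `δ ≥ sup T₀`, relative source `ξ, I`,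
  `S ≥ T₀ + FT-weighted I + defect`, and `FT_ρ(S) ≤ Rb Qm` on the ball ⟹ `‖Ẽ_{n+1}(k,k′)‖ ≤ Rb Qm k k′` on the ball.
Plumbing over landed doors; nothing about the model's sizes is asserted; nothing asserts superconductivity.  0 kit.
-/

noncomputable section

namespace Summit.HubbardSuperconductivity.HubbardSuperconductivity.Theorems.KLRegimeSplit

set_option linter.dupNamespace false -- summit = problem name (single-conjunct summit), D-0017

open Finset Matrix Set Literature.MathematicalPhysics.QuantumLattice Literature.Probability.LatticeModels GrassmannAlgebra
open Summit.HubbardSuperconductivity.HubbardSuperconductivity.Theorems.KLProgrammeCooperResummation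
open Summit.HubbardSuperconductivity.HubbardSuperconductivity.Theorems.KLProgrammeLegKernels
open Summit.HubbardSuperconductivity.HubbardSuperconductivity.Theorems.DispersionFlow
open Summit.HubbardSuperconductivity.HubbardSuperconductivity.Theorems.KLRegimeWick

/-! ## §1 The relative residue of ball-truncated arrays; the export to the frozen forward clause -/

section Export

variable {ι : Type*} [Fintype ι] [DecidableEq ι]

/-- **The relative residue of arrays vanishing off `B × B` vanishes off `B × B`.** -/
theorem kltc_relResidue_eq_zero_off (A₁ A₂ : Matrix ι ι ℂ) (a : ι → ℂ) (B : Finset ι)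
    (h₁ : ∀ x y, ¬(x ∈ B ∧ y ∈ B) → A₁ x y = 0) (h₂ : ∀ x y, ¬(x ∈ B ∧ y ∈ B) → A₂ x y = 0) {x y : ι} (hxy : ¬(x ∈ B ∧ y ∈ B)) :
    (A₁ + A₁ * diagonal a * A₂ - A₂) x y = 0 := by
  rw [kltc_relResidue_apply, h₁ x y hxy, h₂ x y hxy, zero_add, sub_zero]
  refine sum_eq_zero fun c _ => ?_
  by_cases hx : x ∈ B
  · have hy : y ∉ B := fun hy => hxy ⟨hx, hy⟩
    rw [h₂ c y (fun h => hy h.2), mul_zero]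
  · rw [h₁ x c (fun h => hx h.1), zero_mul, zero_mul]

variable {L M : ℕ} [NeZero L] [NeZero M]

/-- **EXPORT: the frozen forward clause from a relative-residue bound** (one `a`-convolution, paid once per scale): for members `ψ₁, ψ₂` at scale `n` with
`‖Ẽ_n(x,y)‖ ≤ T(x,y)` EVERYWHERE (`Ẽ_n` built from `klMemberArrayF … n ψᵢ` and `a = −(t_n[ψ₁] − t_n[ψ₂])`; off the ball both sides may be taken `0`,
`kltc_relResidue_eq_zero_off`), `|A°_n[ψ₂]| ≤ m`, `m·Σ_c|a_c| ≤ 1/3`, and `T + Σ_c T(k,c)‖a_c‖(3m/2) ≤ Tb Qm k k′` on the bare ball, for every class: `PairTransferRelAt … n Tb ψ₁ ψ₂`. -/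
theorem pairTransferRelAt_of_relResidue {β U μ : ℝ} {n : ℕ} {m : ℝ} (hm : 0 ≤ m) {ψ₁ ψ₂ : FreqMomentum L M → ℝ}
    {Tb : TorusSite 2 L → TorusSite 2 L → TorusSite 2 L → ℝ}
    (h : ∀ Qm : TorusSite 2 L, IsPairClassAt L Qm n → ∃ T : TorusSite 2 L → TorusSite 2 L → ℝ,
      (∀ x y, ‖klMemberArrayF L M β U μ n ψ₂ Qm x y‖ ≤ m) ∧
      m * ∑ c, ‖(-(((klTransferWeight L M β μ (klFlowFrameU L M β U μ n) n ψ₁ Qm c -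
          klTransferWeight L M β μ (klFlowFrameU L M β U μ n) n ψ₂ Qm c : ℝ)) : ℂ))‖ ≤ 1 / 3 ∧
      (∀ x y, ‖(klMemberArrayF L M β U μ n ψ₁ Qm + klMemberArrayF L M β U μ n ψ₁ Qm *
          diagonal (fun c => -(((klTransferWeight L M β μ (klFlowFrameU L M β U μ n) n ψ₁ Qm c -
            klTransferWeight L M β μ (klFlowFrameU L M β U μ n) n ψ₂ Qm c : ℝ)) : ℂ)) * klMemberArrayF L M β U μ n ψ₂ Qm -
          klMemberArrayF L M β U μ n ψ₂ Qm) x y‖ ≤ T x y) ∧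
      (∀ k ∈ klBall L μ 0, ∀ k' ∈ klBall L μ 0, T k k' + ∑ c, T k c *
          ‖(-(((klTransferWeight L M β μ (klFlowFrameU L M β U μ n) n ψ₁ Qm c -
            klTransferWeight L M β μ (klFlowFrameU L M β U μ n) n ψ₂ Qm c : ℝ)) : ℂ))‖ * (3 / 2 * m) ≤ Tb Qm k k')) :
    PairTransferRelAt L M β U μ n Tb ψ₁ ψ₂ := by
  intro Qm hQm
  obtain ⟨T, hA₂, hsm, hT, hbud⟩ := h Qm hQm
  obtain ⟨N, h1, h2, hR⟩ := kltc_fwd_of_relResidue _ _ _ T hm hA₂ hsm hT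
  rw [← kltc_one_sub_diag_eq_one_add_diag_neg] at h1 h2
  refine ⟨N, h1, h2, fun k hk k' hk' => ?_⟩
  have hb := hR k k'
  rw [Matrix.sub_apply] at hb
  exact hb.trans (hbud k hk k' hk')

end Export

/-! ## §2 The Ẽ-form keyed step -/

section Keyed

variable (L M : ℕ) [NeZero L] [NeZero M]

set_option maxHeartbeats 1600000 in -- very long hypothesis bundle; plumbing into `kltc_relative_flow_duhamel`
/-- **`pairTransferRelRes_succ_keyed`** — the class-#5 rev-3 producer step in RELATIVE-RESIDUE form (no inverse, no bar-weight convolution): see the module docstring. -/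
theorem pairTransferRelRes_succ_keyed {β U μ : ℝ} {n : ℕ} {m : ℝ} (hm : 0 ≤ m) {ψ₁ ψ₂ χ₁ χ₂ : FreqMomentum L M → ℝ}
    {Rb Rh : TorusSite 2 L → TorusSite 2 L → TorusSite 2 L → ℝ}
    (hhist : ∀ Qm : TorusSite 2 L, IsPairClassAt L Qm n → ∀ k ∈ klBall L μ 0, ∀ k' ∈ klBall L μ 0,
      ‖(klMemberArrayF L M β U μ n χ₁ Qm + klMemberArrayF L M β U μ n χ₁ Qm *
          diagonal (fun c => -(((klTransferWeight L M β μ (klFlowFrameU L M β U μ n) n χ₁ Qm c -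
            klTransferWeight L M β μ (klFlowFrameU L M β U μ n) n χ₂ Qm c : ℝ)) : ℂ)) * klMemberArrayF L M β U μ n χ₂ Qm -
          klMemberArrayF L M β U μ n χ₂ Qm) k k'‖ ≤ Rh Qm k k')
    (hZ : ∀ Λ ∈ Icc (klScale klE0 (n + 1)) (klScale klE0 n), hubbardEffPartitionFnCT L M β U μ 0 (klFlowFrameU L M β U μ (n + 1)) Λ ≠ 0)
    (A₁ A₁' A₂ A₂' : TorusSite 2 L → ℝ → Matrix (TorusSite 2 L) (TorusSite 2 L) ℂ) (b₁ b₁' b₂ b₂' : TorusSite 2 L → ℝ → TorusSite 2 L → ℂ)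
    (a : TorusSite 2 L → ℝ → TorusSite 2 L → ℂ)
    (hA₁def : A₁ = fun Qm t => Matrix.of fun k k' : TorusSite 2 L => if k ∈ klBall L μ 0 ∧ k' ∈ klBall L μ 0 then
      vertexFn L M β (gaussConv ℂ
        (softCovOf L M β μ (klFlowFrameU L M β U μ (n + 1)) ψ₁ + hubbardCovAboveCT L M β μ 0 (klFlowFrameU L M β U μ (n + 1)) (klScale klE0 (n + 1)) -
          hubbardCovAboveCT L M β μ 0 (klFlowFrameU L M β U μ (n + 1)) (klScale klE0 n + t * (klScale klE0 (n + 1) - klScale klE0 n)))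
        (hubbardEffectiveActionCT L M β U μ 0 (klFlowFrameU L M β U μ (n + 1)) (klScale klE0 n + t * (klScale klE0 (n + 1) - klScale klE0 n)))) 4
        ![(((omega0 M, k'), 0), 0), ((((omega0 M).rev, Qm - k'), 1), 0), ((((omega0 M).rev, Qm - k), 1), 1), (((omega0 M, k), 0), 1)]
      else 0)
    (hA₁'def : A₁' = fun Qm t => Matrix.of fun k k' : TorusSite 2 L => if k ∈ klBall L μ 0 ∧ k' ∈ klBall L μ 0 then
      (klScale klE0 (n + 1) - klScale klE0 n) • -((2 : ℂ)⁻¹ * vertexFn L M β (gaussConv ℂ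
        (softCovOf L M β μ (klFlowFrameU L M β U μ (n + 1)) ψ₁ + hubbardCovAboveCT L M β μ 0 (klFlowFrameU L M β U μ (n + 1)) (klScale klE0 (n + 1)) -
          hubbardCovAboveCT L M β μ 0 (klFlowFrameU L M β U μ (n + 1)) (klScale klE0 n + t * (klScale klE0 (n + 1) - klScale klE0 n)))
        (grassmannDerivPairing ℂ
          (Matrix.of fun X Y : HubbardFieldIdx L M => deriv (fun Λ'' : ℝ => hubbardCovAboveCT L M β μ 0 (klFlowFrameU L M β U μ (n + 1)) Λ'' X Y)
            (klScale klE0 n + t * (klScale klE0 (n + 1) - klScale klE0 n)))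
          (hubbardEffectiveActionCT L M β U μ 0 (klFlowFrameU L M β U μ (n + 1)) (klScale klE0 n + t * (klScale klE0 (n + 1) - klScale klE0 n)))
          (hubbardEffectiveActionCT L M β U μ 0 (klFlowFrameU L M β U μ (n + 1)) (klScale klE0 n + t * (klScale klE0 (n + 1) - klScale klE0 n))))) 4
        ![(((omega0 M, k'), 0), 0), ((((omega0 M).rev, Qm - k'), 1), 0), ((((omega0 M).rev, Qm - k), 1), 1), (((omega0 M, k), 0), 1)])
      else 0)
    (hA₂def : A₂ = fun Qm t => Matrix.of fun k k' : TorusSite 2 L => if k ∈ klBall L μ 0 ∧ k' ∈ klBall L μ 0 then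
      vertexFn L M β (gaussConv ℂ
        (softCovOf L M β μ (klFlowFrameU L M β U μ (n + 1)) ψ₂ + hubbardCovAboveCT L M β μ 0 (klFlowFrameU L M β U μ (n + 1)) (klScale klE0 (n + 1)) -
          hubbardCovAboveCT L M β μ 0 (klFlowFrameU L M β U μ (n + 1)) (klScale klE0 n + t * (klScale klE0 (n + 1) - klScale klE0 n)))
        (hubbardEffectiveActionCT L M β U μ 0 (klFlowFrameU L M β U μ (n + 1)) (klScale klE0 n + t * (klScale klE0 (n + 1) - klScale klE0 n)))) 4
        ![(((omega0 M, k'), 0), 0), ((((omega0 M).rev, Qm - k'), 1), 0), ((((omega0 M).rev, Qm - k), 1), 1), (((omega0 M, k), 0), 1)]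
      else 0)
    (hA₂'def : A₂' = fun Qm t => Matrix.of fun k k' : TorusSite 2 L => if k ∈ klBall L μ 0 ∧ k' ∈ klBall L μ 0 then
      (klScale klE0 (n + 1) - klScale klE0 n) • -((2 : ℂ)⁻¹ * vertexFn L M β (gaussConv ℂ
        (softCovOf L M β μ (klFlowFrameU L M β U μ (n + 1)) ψ₂ + hubbardCovAboveCT L M β μ 0 (klFlowFrameU L M β U μ (n + 1)) (klScale klE0 (n + 1)) -
          hubbardCovAboveCT L M β μ 0 (klFlowFrameU L M β U μ (n + 1)) (klScale klE0 n + t * (klScale klE0 (n + 1) - klScale klE0 n)))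
        (grassmannDerivPairing ℂ
          (Matrix.of fun X Y : HubbardFieldIdx L M => deriv (fun Λ'' : ℝ => hubbardCovAboveCT L M β μ 0 (klFlowFrameU L M β U μ (n + 1)) Λ'' X Y)
            (klScale klE0 n + t * (klScale klE0 (n + 1) - klScale klE0 n)))
          (hubbardEffectiveActionCT L M β U μ 0 (klFlowFrameU L M β U μ (n + 1)) (klScale klE0 n + t * (klScale klE0 (n + 1) - klScale klE0 n)))
          (hubbardEffectiveActionCT L M β U μ 0 (klFlowFrameU L M β U μ (n + 1)) (klScale klE0 n + t * (klScale klE0 (n + 1) - klScale klE0 n))))) 4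
        ![(((omega0 M, k'), 0), 0), ((((omega0 M).rev, Qm - k'), 1), 0), ((((omega0 M).rev, Qm - k), 1), 1), (((omega0 M, k), 0), 1)])
      else 0)
    (hb₁def : b₁ = fun Qm t p => -((klBubbleMass L M β μ (klFlowFrameU L M β U μ (n + 1))
        (fun k => ψ₁ k + (hubbardCutoffWeightCT L M β μ (klFlowFrameU L M β U μ (n + 1)) (klScale klE0 (n + 1)) k -
          hubbardCutoffWeightCT L M β μ (klFlowFrameU L M β U μ (n + 1)) (klScale klE0 n + t * (klScale klE0 (n + 1) - klScale klE0 n)) k))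
        (fun k => ψ₁ k + (hubbardCutoffWeightCT L M β μ (klFlowFrameU L M β U μ (n + 1)) (klScale klE0 (n + 1)) k -
          hubbardCutoffWeightCT L M β μ (klFlowFrameU L M β U μ (n + 1)) (klScale klE0 n + t * (klScale klE0 (n + 1) - klScale klE0 n)) k)) Qm p : ℝ) : ℂ))
    (hb₁'def : b₁' = fun Qm t p => (((klScale klE0 (n + 1) - klScale klE0 n) *
        (klBubbleMass L M β μ (klFlowFrameU L M β U μ (n + 1))
            (fun k => deriv (fun Λ' => hubbardCutoffWeightCT L M β μ (klFlowFrameU L M β U μ (n + 1)) Λ' k) (klScale klE0 n + t * (klScale klE0 (n + 1) - klScale klE0 n)))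
            (fun k => ψ₁ k + (hubbardCutoffWeightCT L M β μ (klFlowFrameU L M β U μ (n + 1)) (klScale klE0 (n + 1)) k -
          hubbardCutoffWeightCT L M β μ (klFlowFrameU L M β U μ (n + 1)) (klScale klE0 n + t * (klScale klE0 (n + 1) - klScale klE0 n)) k)) Qm p +
          klBubbleMass L M β μ (klFlowFrameU L M β U μ (n + 1))
            (fun k => ψ₁ k + (hubbardCutoffWeightCT L M β μ (klFlowFrameU L M β U μ (n + 1)) (klScale klE0 (n + 1)) k -
          hubbardCutoffWeightCT L M β μ (klFlowFrameU L M β U μ (n + 1)) (klScale klE0 n + t * (klScale klE0 (n + 1) - klScale klE0 n)) k))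
            (fun k => deriv (fun Λ' => hubbardCutoffWeightCT L M β μ (klFlowFrameU L M β U μ (n + 1)) Λ' k) (klScale klE0 n + t * (klScale klE0 (n + 1) - klScale klE0 n)))
            Qm p) : ℝ) : ℂ))
    (hb₂def : b₂ = fun Qm t p => -((klBubbleMass L M β μ (klFlowFrameU L M β U μ (n + 1))
        (fun k => ψ₂ k + (hubbardCutoffWeightCT L M β μ (klFlowFrameU L M β U μ (n + 1)) (klScale klE0 (n + 1)) k -
          hubbardCutoffWeightCT L M β μ (klFlowFrameU L M β U μ (n + 1)) (klScale klE0 n + t * (klScale klE0 (n + 1) - klScale klE0 n)) k))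
        (fun k => ψ₂ k + (hubbardCutoffWeightCT L M β μ (klFlowFrameU L M β U μ (n + 1)) (klScale klE0 (n + 1)) k -
          hubbardCutoffWeightCT L M β μ (klFlowFrameU L M β U μ (n + 1)) (klScale klE0 n + t * (klScale klE0 (n + 1) - klScale klE0 n)) k)) Qm p : ℝ) : ℂ))
    (hb₂'def : b₂' = fun Qm t p => (((klScale klE0 (n + 1) - klScale klE0 n) *
        (klBubbleMass L M β μ (klFlowFrameU L M β U μ (n + 1))
            (fun k => deriv (fun Λ' => hubbardCutoffWeightCT L M β μ (klFlowFrameU L M β U μ (n + 1)) Λ' k) (klScale klE0 n + t * (klScale klE0 (n + 1) - klScale klE0 n)))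
            (fun k => ψ₂ k + (hubbardCutoffWeightCT L M β μ (klFlowFrameU L M β U μ (n + 1)) (klScale klE0 (n + 1)) k -
          hubbardCutoffWeightCT L M β μ (klFlowFrameU L M β U μ (n + 1)) (klScale klE0 n + t * (klScale klE0 (n + 1) - klScale klE0 n)) k)) Qm p +
          klBubbleMass L M β μ (klFlowFrameU L M β U μ (n + 1))
            (fun k => ψ₂ k + (hubbardCutoffWeightCT L M β μ (klFlowFrameU L M β U μ (n + 1)) (klScale klE0 (n + 1)) k -
          hubbardCutoffWeightCT L M β μ (klFlowFrameU L M β U μ (n + 1)) (klScale klE0 n + t * (klScale klE0 (n + 1) - klScale klE0 n)) k))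
            (fun k => deriv (fun Λ' => hubbardCutoffWeightCT L M β μ (klFlowFrameU L M β U μ (n + 1)) Λ' k) (klScale klE0 n + t * (klScale klE0 (n + 1) - klScale klE0 n)))
            Qm p) : ℝ) : ℂ))
    (hadef : a = fun Qm t p => (b₁ Qm t p - b₂ Qm t p) +
      (-(((klTransferWeight L M β μ (klFlowFrameU L M β U μ (n + 1)) (n + 1) ψ₁ Qm p - klTransferWeight L M β μ (klFlowFrameU L M β U μ (n + 1)) (n + 1) ψ₂ Qm p : ℝ)) : ℂ) -
        (b₁ Qm 1 p - b₂ Qm 1 p)))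
    (hdata : ∀ Qm : TorusSite 2 L, IsPairClassAt L Qm (n + 1) →
      ∃ (ρ₁ ρ₂ : TorusSite 2 L → ℝ) (ηr η₁ η₂ T₀ I S : TorusSite 2 L → TorusSite 2 L → ℝ) (d : TorusSite 2 L → ℝ) (β' δ ξ ξ₁ ξ₂ : ℝ),
        0 ≤ ξ ∧ 0 ≤ ξ₁ ∧ 0 ≤ ξ₂ ∧
        -- a priori sizes of the two member arrays, rates, profiles, smallness, Riccati-defect sups
        (∀ t ∈ Icc (0 : ℝ) 1, ∀ x y, ‖A₁ Qm t x y‖ ≤ m) ∧ (∀ t ∈ Icc (0 : ℝ) 1, ∀ x y, ‖A₂ Qm t x y‖ ≤ m) ∧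
        (∀ t ∈ Icc (0 : ℝ) 1, ∑ c, ‖b₁' Qm t c‖ ≤ β') ∧ (∀ t ∈ Icc (0 : ℝ) 1, ∑ c, ‖b₂' Qm t c‖ ≤ β') ∧
        (∀ t ∈ Icc (0 : ℝ) 1, ∀ c, ‖b₁ Qm t c - b₁ Qm 0 c‖ ≤ ρ₁ c) ∧ (∀ t ∈ Icc (0 : ℝ) 1, ∀ c, ‖b₂ Qm t c - b₂ Qm 0 c‖ ≤ ρ₂ c) ∧
        m * β' ≤ 1 / 3 ∧ m * ∑ c, ρ₁ c ≤ 1 / 3 ∧ m * ∑ c, ρ₂ c ≤ 1 / 3 ∧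
        (∀ t ∈ Icc (0 : ℝ) 1, ∀ x y, ‖(A₁' Qm t + A₁ Qm t * diagonal (b₁' Qm t) * A₁ Qm t) x y‖ ≤ ξ₁) ∧
        (∀ t ∈ Icc (0 : ℝ) 1, ∀ x y, ‖(A₂' Qm t + A₂ Qm t * diagonal (b₂' Qm t) * A₂ Qm t) x y‖ ≤ ξ₂) ∧
        -- the history arrays' a priori size and the START RE-FRAME majorants ((F)(i) lane) against the history objects at frame `K_n`
        (∀ x y, ‖klMemberArrayF L M β U μ n χ₁ Qm x y‖ ≤ m) ∧
        (∀ x y, ‖((A₁ Qm 0 - klMemberArrayF L M β U μ n χ₁ Qm) - (A₂ Qm 0 - klMemberArrayF L M β U μ n χ₂ Qm)) x y‖ ≤ ηr x y) ∧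
        (∀ x y, ‖(A₁ Qm 0 - klMemberArrayF L M β U μ n χ₁ Qm) x y‖ ≤ η₁ x y) ∧
        (∀ x y, ‖(A₂ Qm 0 - klMemberArrayF L M β U μ n χ₂ Qm) x y‖ ≤ η₂ x y) ∧
        (∀ c, ‖a Qm 0 c - -(((klTransferWeight L M β μ (klFlowFrameU L M β U μ n) n χ₁ Qm c -
            klTransferWeight L M β μ (klFlowFrameU L M β U μ n) n χ₂ Qm c : ℝ)) : ℂ)‖ ≤ d c) ∧
        -- the start residue majorant (history bar + re-frame terms; NO convolution of the bar), its sup, the source lines, the four-term input majorant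
        (∀ x y, (if x ∈ klBall L μ 0 ∧ y ∈ klBall L μ 0 then Rh Qm x y else 0) +
            ηr x y + m * ∑ c, η₁ x c * ‖a Qm 0 c‖ + m * m * ∑ c, d c +
            m * ∑ c, ‖(-(((klTransferWeight L M β μ (klFlowFrameU L M β U μ n) n χ₁ Qm c -
            klTransferWeight L M β μ (klFlowFrameU L M β U μ n) n χ₂ Qm c : ℝ)) : ℂ))‖ * η₂ c y ≤ T₀ x y) ∧
        (∀ x y, T₀ x y ≤ δ) ∧
        (∀ t ∈ Icc (0 : ℝ) 1, ∀ x y, ‖((A₁' Qm t + A₁ Qm t * diagonal (b₁' Qm t) * A₁ Qm t) * (1 + diagonal (a Qm t) * A₂ Qm t) +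
            A₁ Qm t * diagonal (a Qm t) * (A₂' Qm t + A₂ Qm t * diagonal (b₂' Qm t) * A₂ Qm t) - (A₂' Qm t + A₂ Qm t * diagonal (b₂' Qm t) * A₂ Qm t)) x y‖ ≤ ξ) ∧
        (∀ x y, (∫ t in (0 : ℝ)..1, ‖((A₁' Qm t + A₁ Qm t * diagonal (b₁' Qm t) * A₁ Qm t) * (1 + diagonal (a Qm t) * A₂ Qm t) +
            A₁ Qm t * diagonal (a Qm t) * (A₂' Qm t + A₂ Qm t * diagonal (b₂' Qm t) * A₂ Qm t) - (A₂' Qm t + A₂ Qm t * diagonal (b₂' Qm t) * A₂ Qm t)) x y‖) ≤ I x y) ∧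
        (∀ x y, T₀ x y +
            (I x y + ∑ c, I x c * ρ₂ c * m + ∑ a', m * ρ₁ a' * I a' y + ∑ a', ∑ c, m * ρ₁ a' * I a' c * ρ₂ c * m) +
            4 / 3 * (δ * Real.exp (m * β' + m * β') + 2 * ξ) * β' * (8 / 3 * ξ₁ + 8 / 3 * ξ₂) ≤ S x y) ∧
        -- the private bar at `n+1` dominates the four-term form of `S` on the bare ball
        (∀ k ∈ klBall L μ 0, ∀ k' ∈ klBall L μ 0, S k k' + ∑ c, S k c * ρ₂ c * (3 / 2 * m) + ∑ a', 3 / 2 * m * ρ₁ a' * S a' k' +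
          ∑ a', ∑ c, 3 / 2 * m * ρ₁ a' * S a' c * ρ₂ c * (3 / 2 * m) ≤ Rb Qm k k')) :
    ∀ Qm : TorusSite 2 L, IsPairClassAt L Qm (n + 1) → ∀ k ∈ klBall L μ 0, ∀ k' ∈ klBall L μ 0,
      ‖(klMemberArrayF L M β U μ (n + 1) ψ₁ Qm + klMemberArrayF L M β U μ (n + 1) ψ₁ Qm *
          diagonal (fun p => -(((klTransferWeight L M β μ (klFlowFrameU L M β U μ (n + 1)) (n + 1) ψ₁ Qm p -
            klTransferWeight L M β μ (klFlowFrameU L M β U μ (n + 1)) (n + 1) ψ₂ Qm p : ℝ)) : ℂ)) * klMemberArrayF L M β U μ (n + 1) ψ₂ Qm -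
        klMemberArrayF L M β U μ (n + 1) ψ₂ Qm) k k'‖ ≤ Rb Qm k k' := by
  intro Qm hQm k hk k' hk'
  obtain ⟨ρ₁, ρ₂, ηr, η₁, η₂, T₀, I, S, d, β', δ, ξ, ξ₁, ξ₂, hξ, hξ₁, hξ₂, hA₁m, hA₂m, hβ₁, hβ₂, hρ₁, hρ₂, hmβ, hZ₁, hZ₂,
    hS₁, hS₂, hH₁, hηr, hη₁, hη₂, hd, hT₀, hδ, hXξ, hI, hS, hbud⟩ := hdata Qm hQm
  -- the two members' flow data (calculus by name)
  obtain ⟨hdA₁, hcA₁, hA₁1, -⟩ := klmf_memberArray_flowData L M β U μ (klFlowFrameU L M β U μ (n + 1)) n ψ₁ Qm hZ (A₁ Qm) (A₁' Qm)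
    (by rw [hA₁def]) (by rw [hA₁'def])
  obtain ⟨hdA₂, hcA₂, hA₂1, -⟩ := klmf_memberArray_flowData L M β U μ (klFlowFrameU L M β U μ (n + 1)) n ψ₂ Qm hZ (A₂ Qm) (A₂' Qm)
    (by rw [hA₂def]) (by rw [hA₂'def])
  obtain ⟨hdb₁, hcb₁, hb₁e⟩ := klmf_rung_data L M β μ (klFlowFrameU L M β U μ (n + 1)) n ψ₁ Qm (b₁ Qm) (b₁' Qm) (by rw [hb₁def]) (by rw [hb₁'def])
  obtain ⟨hdb₂, hcb₂, hb₂e⟩ := klmf_rung_data L M β μ (klFlowFrameU L M β U μ (n + 1)) n ψ₂ Qm (b₂ Qm) (b₂' Qm) (by rw [hb₂def]) (by rw [hb₂'def])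
  obtain ⟨hda, ha1, -⟩ := klmf_relWeight_data L M β μ (klFlowFrameU L M β U μ (n + 1)) n ψ₁ ψ₂ Qm (b₁ Qm) (b₂ Qm) (b₁' Qm) (b₂' Qm) (a Qm)
    hdb₁ hdb₂ hb₁e hb₂e (by rw [hadef])
  obtain ⟨hflow₁, hS₁c⟩ := klmf_riccati_of_defect (A₁ Qm) (A₁' Qm) _ (b₁' Qm) hdA₁ hcA₁ hcb₁ rfl
  obtain ⟨hflow₂, hS₂c⟩ := klmf_riccati_of_defect (A₂ Qm) (A₂' Qm) _ (b₂' Qm) hdA₂ hcA₂ hcb₂ rfl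
  -- the history residue bound, globally (zero off the ball)
  have hQmn : IsPairClassAt L Qm n := isPairClassAt_mono (L := L) hQm (Nat.le_succ n)
  have hEh : ∀ x y, ‖(klMemberArrayF L M β U μ n χ₁ Qm + klMemberArrayF L M β U μ n χ₁ Qm *
      diagonal (fun c => -(((klTransferWeight L M β μ (klFlowFrameU L M β U μ n) n χ₁ Qm c -
        klTransferWeight L M β μ (klFlowFrameU L M β U μ n) n χ₂ Qm c : ℝ)) : ℂ)) * klMemberArrayF L M β U μ n χ₂ Qm -
      klMemberArrayF L M β U μ n χ₂ Qm) x y‖ ≤ (if x ∈ klBall L μ 0 ∧ y ∈ klBall L μ 0 then Rh Qm x y else 0) := by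
    intro x y
    by_cases hxy : x ∈ klBall L μ 0 ∧ y ∈ klBall L μ 0
    · rw [if_pos hxy]; exact hhist Qm hQmn x hxy.1 y hxy.2
    · rw [if_neg hxy, kltc_relResidue_eq_zero_off _ _ _ (klBall L μ 0) (fun x y h => klMemberArrayF_eq_zero_off β U μ n χ₁ Qm h)
        (fun x y h => klMemberArrayF_eq_zero_off β U μ n χ₂ Qm h) hxy, norm_zero]
  -- the start residue by perturbation (no inverse)
  have hE0 : ∀ x y, ‖(A₁ Qm 0 + A₁ Qm 0 * diagonal (a Qm 0) * A₂ Qm 0 - A₂ Qm 0) x y‖ ≤ T₀ x y := fun x y =>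
    (kltc_relResidue_perturb_le _ _ _ _ _ _ (fun x y => if x ∈ klBall L μ 0 ∧ y ∈ klBall L μ 0 then Rh Qm x y else 0) ηr η₁ η₂ d hm
      hH₁ (hA₂m 0 ⟨le_rfl, zero_le_one⟩) hEh hηr hη₁ hη₂ hd x y).trans (hT₀ x y)
  have hδ0 : 0 ≤ δ := ((norm_nonneg _).trans (hE0 k k')).trans (hδ k k')
  have hfin := kltc_relative_flow_duhamel _ _ _ _ _ _ _ _ _ _ _ ρ₁ ρ₂ I S hm hδ0 hξ hξ₁ hξ₂ hdA₁ hdA₂ hdb₁ hdb₂ hda hcb₁ hcb₂ hS₁c hS₂c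
    hflow₁ hflow₂ hA₁m hA₂m hβ₁ hβ₂ hρ₁ hρ₂ hmβ hZ₁ hZ₂ hS₁ hS₂ (fun x y => (hE0 x y).trans (hδ x y)) hXξ hI
    (fun x y => le_trans (by linarith [hE0 x y]) (hS x y)) k k'
  rw [hA₁1, hA₂1, klmf_ballArray_succ_eq_klMemberArrayF, klmf_ballArray_succ_eq_klMemberArrayF, ha1] at hfin
  exact hfin.trans (hbud k hk k' hk')

end Keyed

end Summit.HubbardSuperconductivity.HubbardSuperconductivity.Theorems.KLRegimeSplit

end
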